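import Literature.NumberTheory.ModularForms.SturmCongruenceProofs
import Literature.NumberTheory.ModularForms.GammaTranslatesRational
import Literature.NumberTheory.ModularForms.GammaTranslatesBounded
import HarnessLib

/-!
# Sturm's congruence theorem for `Γ₁(N)` modulo a prime — the discharge

Topic `Literature/NumberTheory/ModularForms`; namespace `Literature.NumberTheory.ModularForms`.
`SturmCongruenceProofs` reduced the named fact `Sturm1987_congruence_modPrime_gamma1`
(`SturmCongruence.lean`; Sturm 1987, Thm. 1, as in Murty 1997, Thm. 5) to the `q`-expansion
principle for the `SL₂(ℤ)`-translates of an integral form (`…_of_translates`, hypothesis `hX`).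
Here `hX` is **proved** (`qExpansion_translates_principle`) from

* rationality of translates over `K = ℚ(ζ_N)` (`GammaTranslatesRational.isRat_slash`: Shimura 1971,
  Thm. 6.6 / Prop. 6.9, via congruence Eisenstein series and Cramer resolvents), and
* bounded denominators of `K`-rational forms (`GammaTranslatesBounded.exists_int_mul_isIntegral_coeff`:
  Shimura 1971, Thm. 3.52, via the tree's Deligne–Serre integral spanning set),

and the named fact is discharged: `Sturm1987_congruence_modPrime_gamma1_holds`.

## References

* [Sturm1987] J. Sturm, *On the congruence of modular forms*, LNM 1240 (1987), 275–280, Thm. 1.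
* [Murty1997] M. R. Murty, *Congruences between modular forms*, in *Analytic Number Theory*
  (Kyoto, 1996), LMS LNS 247 (1997), 309–320, Thm. 5 and §4.
* [ShimuraIATAF1971] G. Shimura, *Introduction to the arithmetic theory of automorphic
  functions*, Princeton (1971), Thm. 3.52, Thm. 6.6, Prop. 6.9.
-/

noncomputable section

namespace Literature.NumberTheory.ModularForms

open scoped MatrixGroups Real CongruenceSubgroup Matrix ModularForm Topology Manifold
open UpperHalfPlane hiding I
open Complex Filter Function ModularForm PowerSeries
open Literature.NumberTheory.EllipticCurves.ModularForms (formSpace coe_mem_formSpace formSpace_mono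
  formSpace_eq_bot_of_neg Gamma_le_Gamma1)

/-- A form on `Γ₁(N)` is a form on `Γ(N)` (as a function, in `formSpace`). [folklore] -/
theorem coe_mem_formSpace_Gamma {N : ℕ} [NeZero N] {k : ℤ} (f : ModularForm (CongruenceSubgroup.Gamma1 N) k) :
    (⇑f : ℍ → ℂ) ∈ formSpace (CongruenceSubgroup.Gamma N) k :=
  formSpace_mono (Subgroup.map_mono (Gamma_le_Gamma1 N)) (coe_mem_formSpace f)

/-- An integral form on `Γ₁(N)` has `K`-rational `q_N`-expansion for every subfield `K`
(`q_N`-coefficients: `a_{m/N}` for `N ∣ m`, else `0`). [folklore] -/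
theorem isRat_coe_of_int {N : ℕ} [NeZero N] {k : ℤ} (K : Subfield ℂ)
    (f : ModularForm (CongruenceSubgroup.Gamma1 N) k) (hf : ∀ n : ℕ, ∃ z : ℤ, PowerSeries.coeff n (qExpansion 1 ⇑f) = (z : ℂ)) :
    IsRat K N ⇑f := by
  intro m
  rw [coeff_qExpansion_nat_eq f (CongruenceSubgroup.strictPeriods_Gamma1 N) N m]
  split_ifs with h
  · obtain ⟨z, hz⟩ := hf (m / N)
    rw [hz]
    exact intCast_mem K z
  · exact zero_mem K

/-- **The `q`-expansion principle for `SL₂(ℤ)`-translates of an integral form on `Γ₁(N)`**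
(Shimura 1971, Thm. 3.52 with Thm. 6.6 / Prop. 6.9; Diamond–Shurman §4.2; the ingredient `hX` of
`Sturm1987_congruence_modPrime_gamma1_of_translates`): for `f ∈ M_k(Γ₁(N))` with integer Fourier
coefficients there is a number field `K` (here `ℚ(ζ_N)`) such that every `f ∣_k γ`, `γ ∈ SL₂(ℤ)`,
has `q_N`-expansion coefficients which, after multiplication by one nonzero `A ∈ K` (here an
integer), lie in `K` and are integral over `ℤ`. [cite: ShimuraIATAF1971, Thm. 3.52, Thm. 6.6, Prop. 6.9] -/
theorem qExpansion_translates_principle (N : ℕ) [NeZero N] (k : ℤ)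
    (f : ModularForm (CongruenceSubgroup.Gamma1 N) k)
    (hf : ∀ n : ℕ, ∃ z : ℤ, PowerSeries.coeff n (qExpansion 1 ⇑f) = (z : ℂ)) :
    ∃ K : IntermediateField ℚ ℂ, FiniteDimensional ℚ K ∧ ∀ γ : SL(2, ℤ), ∃ A : ℂ,
      A ∈ K ∧ A ≠ 0 ∧ ∀ n, A * PowerSeries.coeff n (qExpansion (N : ℝ) (⇑f ∣[k] γ)) ∈ K ∧
        IsIntegral ℤ (A * PowerSeries.coeff n (qExpansion (N : ℝ) (⇑f ∣[k] γ))) := by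
  -- `K = ℚ(ζ_N)`
  set ζ : ℂ := cexp (2 * π * Complex.I / N) with hζ
  have hζint : IsIntegral ℚ ζ :=
    ((Complex.isPrimitiveRoot_exp N (NeZero.ne N)).isIntegral (NeZero.pos N)).tower_top
  let K : IntermediateField ℚ ℂ := IntermediateField.adjoin ℚ {ζ}
  have hKfd : FiniteDimensional ℚ K := IntermediateField.adjoin.finiteDimensional hζint
  have hζK : ζ ∈ K.toSubfield := IntermediateField.mem_adjoin_simple_self ℚ ζ
  refine ⟨K, hKfd, fun γ ↦ ?_⟩
  have hg : (⇑f : ℍ → ℂ) ∈ formSpace (CongruenceSubgroup.Gamma N) k := coe_mem_formSpace_Gamma f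
  have hγmem : (⇑f : ℍ → ℂ) ∣[k] γ ∈ formSpace (CongruenceSubgroup.Gamma N) k :=
    slash_mem_formSpace_Gamma hg γ
  have hγK : IsRat K.toSubfield N ((⇑f : ℍ → ℂ) ∣[k] γ) :=
    isRat_slash hζK hg (isRat_coe_of_int K.toSubfield f hf) γ
  rcases lt_or_ge k 0 with hk | hk
  · -- negative weight: everything vanishes
    have h0 : (⇑f : ℍ → ℂ) ∣[k] γ = 0 := by
      have := formSpace_eq_bot_of_neg (Γ := ((CongruenceSubgroup.Gamma N : Subgroup SL(2, ℤ)) :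
        Subgroup (GL (Fin 2) ℝ))) hk
      rw [this] at hγmem
      exact hγmem
    refine ⟨1, one_mem _, one_ne_zero, fun n ↦ ?_⟩
    rw [h0, qExpansion_zero, map_zero, mul_zero]
    exact ⟨zero_mem _, isIntegral_zero⟩
  · obtain ⟨D, hD0, hD⟩ := exists_int_mul_isIntegral_coeff K (by omega) hγmem hγK
    refine ⟨D, intCast_mem _ D, by exact_mod_cast hD0, fun n ↦ ⟨mul_mem (intCast_mem _ D) (hγK n), hD n⟩⟩

/-- **Sturm's congruence theorem for `Γ₁(N)` modulo a prime `p ∤ N`** (Sturm 1987, Thm. 1; Murty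
1997, Thm. 5): the named fact `Sturm1987_congruence_modPrime_gamma1` holds — an integral form on
`Γ₁(N)` whose first `⌊k[SL₂(ℤ):Γ₁(N)]/12⌋ + 1` Fourier coefficients are divisible by `p` has all
its coefficients divisible by `p`.  Proof: `Sturm1987_congruence_modPrime_gamma1_of_translates`
(valuation-ideal version of the norm argument, `SturmCongruenceProofs`) applied to the
`q`-expansion principle for translates proved above. [cite: Murty1997, Thm. 5 and §4] -/
theorem Sturm1987_congruence_modPrime_gamma1_holds : Sturm1987_congruence_modPrime_gamma1 :=
  Sturm1987_congruence_modPrime_gamma1_of_translates fun N _ k f hf ↦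
    qExpansion_translates_principle N k f hf

end Literature.NumberTheory.ModularForms

end
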